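import Literature.AlgebraicGeometry.HodgeTheory.MotivatedClassesProofs
import HarnessLib

/-!
# André's "`B` ⇒ `A_mot(X) ⊆ A(X)`" on the real carriers: the one missing input (multiplicativity of
# algebraic classes, Voisin II Prop. 9.20) named, and the assembly

Family `hodge`, layer `Literature/AlgebraicGeometry/HodgeTheory`. Companion of `MotivatedClasses.lean`
(the named fact `Andre1996_motivatedClasses_le_algebraicClasses_of_standardConjectureB`: Y. André,
*Pour une théorie inconditionnelle des motifs*, Publ. Math. IHÉS 83 (1996), §2.1, remark following
Déf. 1, "`A_mot(X) = A(X)` si pour tout schéma `Y` dans `𝒱`, polarisé, l'involution de Lefschetz est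
donnée par une correspondance algébrique") and of `MotivatedClassesProofs.lean`, which PROVES the
reduction `motivatedClasses_le_algebraicClasses_of_standardConjectureB_of_cupProduct`: the fact follows
from the single input "on every smooth projective complex `V`, the cup product of algebraic classes is
algebraic, `Nᵃ H²ᵃ ∪ Nᵇ H²ᵇ ⊆ Nᵃ⁺ᵇ H^{2(a+b)}`" — C. Voisin, *Hodge Theory and Complex Algebraic
Geometry II* (2003), §9.2.4, Prop. 9.20 ("`cl(Z · Z') = cl(Z) ∪ cl(Z')`") read on the coniveau
carrier `algebraicClasses V p = Nᵖ H²ᵖ(V(ℂ); ℂ)` of the layer (by purity, Fulton §19.1, the `ℂ`-span of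
the cycle classes). The implicit argument of André's "il est clair" is then: `*_L β = γ^* β` is
algebraic (correspondences: flat pull-back, product, proper push-forward), so is `α ∪ *_L β`, so is
`pr_{X*}(α ∪ *_L β)` — steps (1)–(5) of `MotivatedClassesProofs`, all proved there except the two
products. This file names that input and records the assembly:

* `Voisin2003_cupProduct_algebraicClasses` — Prop. 9.20 on the coniveau carrier, for every smooth
  projective complex `V`;
* `Andre1996_motivatedClasses_le_algebraicClasses_of_standardConjectureB_holds_of` — the assembly.

In the tree the input is itself reduced (PROVED, `AlgebraicClassesCup.cupProduct_mem_algebraicClasses_of_moving`)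
to the moving of supports (purity, Fulton §19.1 Lemma 19.1.1 + Chow's moving lemma, Voisin II
Lemma 9.22 / Fulton §11.4 + the support of a cycle class, Voisin II Lemma 9.18), and holds
unconditionally in the cases `AlgebraicClassesCup.cupProduct_mem_algebraicClasses_zero_right`,
`AmbientClassesMoving.projectiveSpace_cupProduct_mem_algebraicClasses`,
`AlgebraicClassesCupAbelianVariety`, `SupportedClassesIrreducible`; an equivalent single-immersion form
is `AlgebraicClassesExteriorProduct.cupProduct_mem_algebraicClasses_of_forall_map_diagonal`
(Prop. 9.21 (i) for diagonals).

## References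

* [Andre1996Motifs] Y. André, Publ. Math. IHÉS 83 (1996) 5–49: §2.1 Déf. 1 and the remark following it
  (p. 14), §0.3 (pp. 7–8).
* [VoisinHodgeII2003] C. Voisin, Hodge Theory and Complex Algebraic Geometry II (CUP 2003), §9.2.4
  Lemma 9.18, Prop. 9.20, Prop. 9.21, Lemma 9.22.
* [Fulton1998] W. Fulton, Intersection Theory, 2nd ed. (1998), §11.4 (moving lemma), §19.1
  (Lemma 19.1.1, cycle map and homological equivalence).
-/

noncomputable section

open CategoryTheory AlgebraicGeometry MonoidalCategory CartesianMonoidalCategory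
open Literature.AlgebraicTopology.SingularHomology Literature.Geometry.Kaehler

namespace Literature.AlgebraicGeometry.HodgeTheory

/-- **The cup product of algebraic classes is algebraic** (C. Voisin, *Hodge Theory and Complex
Algebraic Geometry II*, §9.2.4, Prop. 9.20: `cl(Z · Z') = cl(Z) ∪ cl(Z')` for properly intersecting
cycles; with Chow's moving lemma, Lemma 9.22 (a rationally equivalent cycle meeting a given one
properly), and the invariance of `cl` under rational equivalence, Lemma 9.18, the `ℚ`- (or `ℂ`-)
span of the cycle classes is a subring of `H^{2*}(V(ℂ))` — Fulton,
*Intersection Theory*, §19.1: the cycle map `A*(V) → H^{2*}(V)` is a ring homomorphism for `V` smooth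
projective). On the real carriers of the layer, where `algebraicClasses V p = Nᵖ H²ᵖ(V(ℂ); ℂ)` is the
coniveau (classes dying off a Zariski-closed subset of codimension `≥ p`; equal to the span of cycle
classes by purity, Fulton §19.1 Lemma 19.1.1): for every smooth projective complex `V` of dimension
`d` and all `a`, `b`, `x ∈ Nᵃ H²ᵃ`, `y ∈ Nᵇ H²ᵇ` imply `x ∪ y ∈ Nᵃ⁺ᵇ H^{2(a+b)}` (`cupProduct`, the
tree's Alexander–Whitney product). This is verbatim the hypothesis `hcup` of the reduction theorem
`…_of_cupProduct` of `MotivatedClassesProofs` (André's remark from the multiplicativity); the tree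
reduces it to the moving of supports (`cupProduct_mem_algebraicClasses_of_moving`,
`AlgebraicClassesCup`). A THEOREM in print (status: proved classically; unproved in the tree). [cite: VoisinHodgeII2003, §9.2.4 Prop. 9.20 with Lemma 9.18 and Lemma 9.22]
[cite: Fulton1998, §19.1 and §11.4] -/
def Voisin2003_cupProduct_algebraicClasses : Prop :=
  ∀ ⦃d : ℕ⦄ ⦃V : Motives.SchemeOver ℂ⦄, Motives.IsSmoothProjective d V →
    ∀ ⦃a b : ℕ⦄ ⦃x : complexBetti V (2 * a)⦄ ⦃y : complexBetti V (2 * b)⦄,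
      x ∈ algebraicClasses V a → y ∈ algebraicClasses V b →
        cupProduct (two_mul_add_two_mul a b) x y ∈ algebraicClasses V (a + b)

/-- **Assembly (André 1996, §2.1 "il est clair" made explicit): `B` ⇒ `A_mot(X) ⊆ A(X)` from the
multiplicativity of algebraic classes.** A direct call to the PROVED reduction
`motivatedClasses_le_algebraicClasses_of_standardConjectureB_of_cupProduct` (under `B(Z)`,
`*_L β = γ^* β` is algebraic by flat pull-back, product and proper push-forward; then `α ∪ *_L β` and
its Gysin image are algebraic). [cite: Andre1996Motifs, §2.1 remark following Déf. 1 (p. 14)] -/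
theorem Andre1996_motivatedClasses_le_algebraicClasses_of_standardConjectureB_holds_of
    (h : Voisin2003_cupProduct_algebraicClasses) :
    Andre1996_motivatedClasses_le_algebraicClasses_of_standardConjectureB :=
  motivatedClasses_le_algebraicClasses_of_standardConjectureB_of_cupProduct h

end Literature.AlgebraicGeometry.HodgeTheory

end
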